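import Summits.Ventures.CertifiedManyBodySolver.Theorems.TcThermcert1HighTempPolymerCombinatorics
import HarnessLib

/-!
# High-temperature current clustering for TcThermcert1's Hypothesis C — part 2b: rooted animals and the distance bound

Helper file for route `TcThermcert1` (crux K1′ `ThermalStiffnessCeilingU8b8_le_7o44`, item `stmt-Ventures-24560`; line
`Cruxes/ThermalStiffnessCeilingU8b8_le_7o44/Lines/gauge_qbp_far_seam.lean`, small-`β` rung `stub_currentClustering8_smallBeta`).
Continuation of part 2 (`TcThermcert1HighTempPolymerCombinatorics.lean`: reachability of sites from the roots through a set of cells):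

* §3a every vertex of an admissible cell set is reachable; admissible and far cell sets have disjoint supports.
* §3 the cells reachable from ONE root form a `ShareVertex`-connected family containing a cell through the root; with a site
  "distance" of cell-diameter `≤ 1` satisfying the triangle inequality, every reachable site is within distance `|K|` of a root
  (first-exit growth, tree lemma `exists_step_out`); an admissible `K` is the union of its two rooted reachable families, each of which
  is empty or a member of the rooted animal family.
* §4 the rooted lattice-animal bound `Σ_{Y connected ∋ a cell through x} λ^{|Y|} ≤ m · 2λ` (tree: `sum_pow_card_le_of_connected`).

[cite: FriedliVelenik2017, Lemma 3.38 and eq. (5.27)]; [cite: Ueltschi1999, §2.3]. No physics; no definitions; no `sorry`. Nothing here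
bears on `T_c` or on superconductivity in the Hubbard model.
-/

namespace Summit.Ventures.CertifiedManyBodySolver.Theorems.TcThermcert1.HighTempCurrentClustering

open Finset
open Literature.Probability.LatticeModels
open scoped Classical


/-! ## §3a Supports of admissible and far cell sets -/

section Supports

variable {α V : Type*} {verts : V → Finset α}

/-- **Every vertex of an admissible `K` is reachable** (one more step through the cell itself). [folklore] -/
theorem verts_reach_of_admissible {K : Finset V} {R₀ : Finset α}
    (hK : ∀ Z ∈ K, ∃ w ∈ verts Z, ∃ r ∈ R₀, Relation.ReflTransGen (fun x y : α => ∃ Z ∈ K, x ∈ verts Z ∧ y ∈ verts Z) r w) :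
    ∀ Z ∈ K, ∀ x ∈ verts Z, ∃ r ∈ R₀, Relation.ReflTransGen (fun x y : α => ∃ Z ∈ K, x ∈ verts Z ∧ y ∈ verts Z) r x := by
  intro Z hZ x hx
  obtain ⟨w, hw, r, hr, hrw⟩ := hK Z hZ
  exact ⟨r, hr, hrw.tail ⟨Z, hZ, hw, hx⟩⟩

/-- **Admissible and far cell sets have disjoint supports.** [folklore] -/
theorem disjoint_verts_of_admissible_far {K T : Finset V} {R₀ : Finset α}
    (hK : ∀ Z ∈ K, ∃ w ∈ verts Z, ∃ r ∈ R₀, Relation.ReflTransGen (fun x y : α => ∃ Z ∈ K, x ∈ verts Z ∧ y ∈ verts Z) r w)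
    (hT : ∀ Z ∈ T, ∀ w ∈ verts Z, ¬ ∃ r ∈ R₀, Relation.ReflTransGen (fun x y : α => ∃ Z ∈ K, x ∈ verts Z ∧ y ∈ verts Z) r w) :
    ∀ Z ∈ K, ∀ Z' ∈ T, Disjoint (verts Z) (verts Z') := by
  intro Z hZ Z' hZ'
  rw [Finset.disjoint_left]
  intro x hx hx'
  exact hT Z' hZ' x hx' (verts_reach_of_admissible hK Z hZ x hx)

end Supports

/-! ## §3 One root: connectivity of the reachable cells and the distance bound -/

section OneRoot

variable {α V : Type*} [DecidableEq α] [DecidableEq V] {verts : V → Finset α}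

omit [DecidableEq V] in
/-- **The cells reachable from one root are chained to any cell through the root** inside the reachable family
(induction along the site path). [folklore] -/
theorem chain_of_reach {K : Finset V} {x : α} {Z₀ : V} (hZ₀ : Z₀ ∈ K) (hx : x ∈ verts Z₀) {w : α}
    (hw : Relation.ReflTransGen (fun x y : α => ∃ Z ∈ K, x ∈ verts Z ∧ y ∈ verts Z) x w) :
    ∀ Z ∈ K, w ∈ verts Z →
      Relation.ReflTransGen (fun Z Z' : V => ShareVertex verts Z Z' ∧
        Z ∈ K.filter (fun Z => ∃ w ∈ verts Z, Relation.ReflTransGen (fun x y : α => ∃ Z ∈ K, x ∈ verts Z ∧ y ∈ verts Z) x w) ∧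
        Z' ∈ K.filter (fun Z => ∃ w ∈ verts Z, Relation.ReflTransGen (fun x y : α => ∃ Z ∈ K, x ∈ verts Z ∧ y ∈ verts Z) x w))
        Z₀ Z := by
  induction hw with
  | refl =>
    intro Z hZ hxZ
    exact Relation.ReflTransGen.single ⟨⟨x, Finset.mem_inter.2 ⟨hx, hxZ⟩⟩,
      Finset.mem_filter.2 ⟨hZ₀, x, hx, Relation.ReflTransGen.refl⟩,
      Finset.mem_filter.2 ⟨hZ, x, hxZ, Relation.ReflTransGen.refl⟩⟩
  | @tail b c hxb hbc ih =>
    intro Z hZ hcZ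
    obtain ⟨Z₁, hZ₁, hbZ₁, hcZ₁⟩ := hbc
    have h1 := ih Z₁ hZ₁ hbZ₁
    exact h1.tail ⟨⟨c, Finset.mem_inter.2 ⟨hcZ₁, hcZ⟩⟩,
      Finset.mem_filter.2 ⟨hZ₁, b, hbZ₁, hxb⟩,
      Finset.mem_filter.2 ⟨hZ, c, hcZ, hxb.tail ⟨Z₁, hZ₁, hbZ₁, hcZ₁⟩⟩⟩

omit [DecidableEq V] in
/-- **The reachable family of one root is `ShareVertex`-connected** (when some cell of `K` contains the root). [folklore] -/
theorem isRConnected_reachCells {K : Finset V} {x : α} {Z₀ : V} (hZ₀ : Z₀ ∈ K) (hx : x ∈ verts Z₀) :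
    IsRConnected (ShareVertex verts)
      (K.filter (fun Z => ∃ w ∈ verts Z, Relation.ReflTransGen (fun x y : α => ∃ Z ∈ K, x ∈ verts Z ∧ y ∈ verts Z) x w)) := by
  refine ⟨⟨Z₀, Finset.mem_filter.2 ⟨hZ₀, x, hx, Relation.ReflTransGen.refl⟩⟩, fun v hv w hw => ?_⟩
  obtain ⟨hvK, a, ha, hxa⟩ := Finset.mem_filter.1 hv
  obtain ⟨hwK, b, hb, hxb⟩ := Finset.mem_filter.1 hw
  have h1 := chain_of_reach hZ₀ hx hxa v hvK ha
  have h2 := chain_of_reach hZ₀ hx hxb w hwK hb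
  exact (reflTransGen_symm_of_symm (fun Z Z' h => shareVertex_symm Z Z' h) h1).trans h2

omit [DecidableEq V] in
/-- The reachable family of a root is empty unless some cell of `K` contains the root. [folklore] -/
theorem reachCells_eq_empty_or {K : Finset V} {x : α} :
    K.filter (fun Z => ∃ w ∈ verts Z, Relation.ReflTransGen (fun x y : α => ∃ Z ∈ K, x ∈ verts Z ∧ y ∈ verts Z) x w) = ∅ ∨
      ∃ Z₀ ∈ K, x ∈ verts Z₀ := by
  by_cases h : ∃ Z₀ ∈ K, x ∈ verts Z₀
  · exact Or.inr h
  · refine Or.inl (Finset.filter_eq_empty_iff.2 fun Z hZ hw => ?_)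
    obtain ⟨w, hwZ, hxw⟩ := hw
    rcases hxw.cases_head with rfl | ⟨c, ⟨Z', hZ', hxZ', -⟩, -⟩
    · exact h ⟨Z, hZ, hwZ⟩
    · exact h ⟨Z', hZ', hxZ'⟩

/-- **Distance bound in a rooted connected family** (first-exit growth): if the cells have `D`-diameter `≤ 1` and `D` satisfies the
triangle inequality, every vertex of a `ShareVertex`-connected family `Y` containing a cell through `x` is within `D`-distance
`|Y|` of `x`. [cite: FriedliVelenik2017, Lemma 3.38 (growth of connected sets)] -/
theorem dist_le_card_of_isRConnected (D : α → α → ℕ) (htri : ∀ x y z, D x z ≤ D x y + D y z)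
    (hdiam : ∀ Z : V, ∀ y ∈ verts Z, ∀ y' ∈ verts Z, D y y' ≤ 1) {Y : Finset V}
    (hY : IsRConnected (ShareVertex verts) Y) {Z₀ : V} (hZ₀ : Z₀ ∈ Y) {x : α} (hx : x ∈ verts Z₀) :
    ∀ Z ∈ Y, ∀ y ∈ verts Z, D x y ≤ Y.card := by
  -- grow a subfamily `T ⊆ Y` through `Z₀`, one cell at a time, keeping the distance bound
  have key : ∀ j, j + 1 ≤ Y.card → ∃ T ⊆ Y, Z₀ ∈ T ∧ T.card = j + 1 ∧ ∀ Z ∈ T, ∀ y ∈ verts Z, D x y ≤ j + 1 := by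
    intro j
    induction j with
    | zero =>
      intro _
      refine ⟨{Z₀}, by simpa using hZ₀, Finset.mem_singleton_self Z₀, Finset.card_singleton Z₀, fun Z hZ y hy => ?_⟩
      rw [Finset.mem_singleton.1 hZ] at hy
      exact hdiam Z₀ x hx y hy
    | succ j ih =>
      intro hj
      obtain ⟨T, hTY, hZ₀T, hTcard, hTD⟩ := ih (by omega)
      obtain ⟨s, hsY, hsT⟩ : ∃ s ∈ Y, s ∉ T := by
        by_contra h
        push Not at h
        have := Finset.card_le_card (show Y ⊆ T from h)
        omega
      obtain ⟨Z₁, Z₂, hZ₁T, hZ₂T, hZ₂Y, hsh⟩ := exists_step_out (hY.2 Z₀ hZ₀ s hsY) hZ₀T hsT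
      refine ⟨insert Z₂ T, Finset.insert_subset hZ₂Y hTY, Finset.mem_insert_of_mem hZ₀T,
        by rw [Finset.card_insert_of_notMem hZ₂T, hTcard], fun Z hZ y hy => ?_⟩
      rcases Finset.mem_insert.1 hZ with rfl | hZT
      · obtain ⟨w, hw⟩ := hsh
        have h1 := hTD Z₁ hZ₁T w (Finset.mem_inter.1 hw).1
        have h2 := hdiam Z w (Finset.mem_inter.1 hw).2 y hy
        have h3 := htri x w y
        omega
      · have := hTD Z hZT y hy
        omega
  have hcard : 1 ≤ Y.card := Finset.card_pos.2 ⟨Z₀, hZ₀⟩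
  obtain ⟨T, hTY, -, hTcard, hTD⟩ := key (Y.card - 1) (by omega)
  have hTY' : T = Y := Finset.eq_of_subset_of_card_le hTY (by omega)
  intro Z hZ y hy
  have := hTD Z (hTY' ▸ hZ) y hy
  omega

/-- **Every reachable site is within distance `|K|` of a root.** [folklore] -/
theorem exists_root_dist_le_card (D : α → α → ℕ) (hD0 : ∀ x, D x x = 0) (htri : ∀ x y z, D x z ≤ D x y + D y z)
    (hdiam : ∀ Z : V, ∀ y ∈ verts Z, ∀ y' ∈ verts Z, D y y' ≤ 1) {K : Finset V} {R₀ : Finset α} {y : α}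
    (hy : ∃ r ∈ R₀, Relation.ReflTransGen (fun x y : α => ∃ Z ∈ K, x ∈ verts Z ∧ y ∈ verts Z) r y) :
    ∃ r ∈ R₀, D r y ≤ K.card := by
  obtain ⟨r, hr, hry⟩ := hy
  refine ⟨r, hr, ?_⟩
  rcases eq_or_exists_cell_of_reach hry with rfl | ⟨Z, hZ, hyZ⟩
  · rw [hD0]; exact Nat.zero_le _
  · -- `Z` lies in the family reachable from `r`, which is connected and contains a cell through `r`
    set Y := K.filter (fun Z => ∃ w ∈ verts Z,
      Relation.ReflTransGen (fun x y : α => ∃ Z ∈ K, x ∈ verts Z ∧ y ∈ verts Z) r w) with hYdef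
    have hZY : Z ∈ Y := Finset.mem_filter.2 ⟨hZ, y, hyZ, hry⟩
    rcases reachCells_eq_empty_or (K := K) (x := r) (verts := verts) with h0 | ⟨Z₀, hZ₀, hrZ₀⟩
    · rw [← hYdef] at h0
      rw [h0] at hZY
      exact absurd hZY (Finset.notMem_empty Z)
    · have hconn := isRConnected_reachCells (verts := verts) hZ₀ hrZ₀
      have hZ₀Y : Z₀ ∈ Y := Finset.mem_filter.2 ⟨hZ₀, r, hrZ₀, Relation.ReflTransGen.refl⟩
      exact (dist_le_card_of_isRConnected D htri hdiam hconn hZ₀Y hrZ₀ Z hZY y hyZ).trans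
        (Finset.card_le_card (Finset.filter_subset _ K))

/-- **An admissible `K` is the union of its two rooted reachable families** (roots `a`, `b`). [folklore] -/
theorem eq_union_reachCells_of_admissible {K : Finset V} {a b : α}
    (hK : ∀ Z ∈ K, ∃ w ∈ verts Z, ∃ r ∈ ({a, b} : Finset α),
      Relation.ReflTransGen (fun x y : α => ∃ Z ∈ K, x ∈ verts Z ∧ y ∈ verts Z) r w) :
    K = K.filter (fun Z => ∃ w ∈ verts Z, Relation.ReflTransGen (fun x y : α => ∃ Z ∈ K, x ∈ verts Z ∧ y ∈ verts Z) a w) ∪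
      K.filter (fun Z => ∃ w ∈ verts Z, Relation.ReflTransGen (fun x y : α => ∃ Z ∈ K, x ∈ verts Z ∧ y ∈ verts Z) b w) := by
  ext Z
  simp only [Finset.mem_union, Finset.mem_filter]
  constructor
  · intro hZ
    obtain ⟨w, hw, r, hr, hrw⟩ := hK Z hZ
    rcases Finset.mem_insert.1 hr with rfl | hr
    · exact Or.inl ⟨hZ, w, hw, hrw⟩
    · rw [Finset.mem_singleton.1 hr] at hrw
      exact Or.inr ⟨hZ, w, hw, hrw⟩
  · rintro (⟨hZ, -⟩ | ⟨hZ, -⟩) <;> exact hZ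

omit [DecidableEq V] in
/-- The rooted reachable family of `K ⊆ P` is empty or a member of the ROOTED ANIMAL FAMILY of `P` at `x`
(connected subfamilies of `P` containing a cell through `x`). [folklore] -/
theorem reachCells_eq_empty_or_mem {K P : Finset V} (hKP : K ⊆ P) (x : α) :
    K.filter (fun Z => ∃ w ∈ verts Z, Relation.ReflTransGen (fun x y : α => ∃ Z ∈ K, x ∈ verts Z ∧ y ∈ verts Z) x w) = ∅ ∨
      K.filter (fun Z => ∃ w ∈ verts Z, Relation.ReflTransGen (fun x y : α => ∃ Z ∈ K, x ∈ verts Z ∧ y ∈ verts Z) x w) ∈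
        P.powerset.filter (fun Y => IsRConnected (ShareVertex verts) Y ∧ ∃ Z ∈ Y, x ∈ verts Z) := by
  rcases reachCells_eq_empty_or (K := K) (x := x) (verts := verts) with h | ⟨Z₀, hZ₀, hx⟩
  · exact Or.inl h
  · refine Or.inr (Finset.mem_filter.2 ⟨Finset.mem_powerset.2 ((Finset.filter_subset _ K).trans hKP),
      isRConnected_reachCells hZ₀ hx, Z₀, Finset.mem_filter.2 ⟨hZ₀, x, hx, Relation.ReflTransGen.refl⟩, hx⟩)

end OneRoot

/-! ## §4 The rooted lattice-animal bound -/

section Animals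

variable {α V : Type*} [DecidableEq α] [DecidableEq V] {verts : V → Finset α}

/-- **Rooted animal bound**: with neighbour lists of size `≤ Δ` for `ShareVertex`, `0 ≤ λ`, `(Δ+1)² λ ≤ 1/2`, and at most `m` cells of
`P` through the site `x`, `Σ_{Y ⊆ P connected, ∋ a cell through x} λ^{|Y|} ≤ m · (2λ)` (one application of the tree's
`sum_pow_card_le_of_connected` per cell through `x`). [cite: FriedliVelenik2017, eq. (5.27)] -/
theorem sum_pow_card_rooted_le {nbr : V → Finset V} {Δ : ℕ} (hΔ : ∀ Z, (nbr Z).card ≤ Δ)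
    (hnbr : ∀ Z Z', ShareVertex verts Z Z' → Z' ∈ nbr Z) {lam : ℝ} (hlam : 0 ≤ lam)
    (hsmall : ((Δ : ℝ) + 1) ^ 2 * lam ≤ 1 / 2) (x : α) (P : Finset V) {m : ℕ}
    (hm : (P.filter fun Z => x ∈ verts Z).card ≤ m) :
    ∑ Y ∈ P.powerset.filter (fun Y => IsRConnected (ShareVertex verts) Y ∧ ∃ Z ∈ Y, x ∈ verts Z), lam ^ Y.card ≤
      m * (2 * lam) := by
  set 𝒴 := P.powerset.filter (fun Y => IsRConnected (ShareVertex verts) Y ∧ ∃ Z ∈ Y, x ∈ verts Z) with h𝒴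
  set C := P.filter fun Z => x ∈ verts Z with hC
  -- each member of the family contains at least one cell of `C`
  have h1 : ∀ Y ∈ 𝒴, lam ^ Y.card ≤ ∑ q ∈ C with q ∈ Y, lam ^ Y.card := by
    intro Y hY
    obtain ⟨hYP, -, Z, hZY, hxZ⟩ := Finset.mem_filter.1 hY
    have hZC : Z ∈ C.filter (fun q => q ∈ Y) :=
      Finset.mem_filter.2 ⟨Finset.mem_filter.2 ⟨Finset.mem_powerset.1 hYP hZY, hxZ⟩, hZY⟩
    rw [Finset.sum_const, nsmul_eq_mul]
    have hc : (1 : ℝ) ≤ (C.filter (fun q => q ∈ Y)).card := by exact_mod_cast Finset.card_pos.2 ⟨Z, hZC⟩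
    nlinarith [pow_nonneg hlam Y.card]
  refine (Finset.sum_le_sum h1).trans ?_
  rw [Finset.sum_comm' (t' := C) (s' := fun q => 𝒴.filter fun Y => q ∈ Y) (by
    intro Y q
    simp only [Finset.mem_filter]
    tauto)]
  have h2 : ∀ q ∈ C, ∑ Y ∈ 𝒴.filter (fun Y => q ∈ Y), lam ^ Y.card ≤ 2 * lam := by
    intro q _
    refine sum_pow_card_le_of_connected (fun Z Z' h => shareVertex_symm Z Z' h) hΔ hnbr hlam hsmall q _ fun Y hY => ?_
    obtain ⟨hY, hqY⟩ := Finset.mem_filter.1 hY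
    exact ⟨hqY, (Finset.mem_filter.1 hY).2.1⟩
  calc ∑ q ∈ C, ∑ Y ∈ 𝒴.filter (fun Y => q ∈ Y), lam ^ Y.card ≤ ∑ _q ∈ C, 2 * lam := Finset.sum_le_sum h2
    _ = C.card * (2 * lam) := by rw [Finset.sum_const, nsmul_eq_mul]
    _ ≤ m * (2 * lam) := by gcongr

end Animals

end Summit.Ventures.CertifiedManyBodySolver.Theorems.TcThermcert1.HighTempCurrentClustering
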